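import Summits.KontsevichZagierPeriods.KontsevichZagierPeriods.Theorems.RootDecompZetaThreeFrontierWordRungTwoP4a

/-! # `RootDecompZetaThreeFrontierWordRungTwoP4` — part 2/2 of the mechanical ≤175-line split of `P4src.lean`
(split by the decomp-kz census seat for landing; mathematics unchanged; part 2 continues part 1). -/

noncomputable section

namespace Summit.KontsevichZagierPeriods.RootDecompZetaThreeFrontier.WordLayer
open Set MeasureTheory MvPolynomial
open Literature.NumberTheory.Transcendental
open Summit.KontsevichZagierPeriods.KontsevichZagierPeriods.Theses.RootDecompZetaThreeFrontier
  (HigherWeightDescent)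
open Summit.KontsevichZagierPeriods.KontsevichZagierPeriods.Theses.LinRedNormalForm
  (DihedralNormalForm MzvKernelInKZ HoffmanSpanInKZ HoffmanIndependence)

section RouteVocabularyMoves














open Literature.ModelTheory.ExponentialFields (IsSemialgebraic)

/-! (private copy of `strictAnti_fin_one` — dedup.landed / split policy; origin part RootDecompZetaThreeFrontierWordRungTwoP1) -/
/-- Auxiliary step `strictAnti_fin_one`. [bookkeeping] -/
private theorem strictAnti_fin_one (y : Fin 1 → ℝ) : StrictAnti y := fun a b hab =>
  absurd hab (by rw [Subsingleton.elim a b]; exact lt_irrefl _)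

/-! (private copy of `mem_simplex_one_iff` — dedup.landed / split policy; origin part RootDecompZetaThreeFrontierWordRungTwoP1) -/
/-- Membership in `simplex_one_iff`, unfolded. [bookkeeping] -/
private theorem mem_simplex_one_iff (y : Fin 1 → ℝ) : y ∈ KZ.openOrderedSimplex 1 ↔ 0 < y 0 ∧ y 0 < 1 := by
  constructor
  · rintro ⟨h0, h1, -⟩
    exact ⟨h0 0, h1 0⟩
  · rintro ⟨h0, h1⟩
    refine ⟨fun i => ?_, fun i => ?_, strictAnti_fin_one y⟩
    · rw [Fin.fin_one_eq_zero i]; exact h0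
    · rw [Fin.fin_one_eq_zero i]; exact h1

/-! (private copy of `mem_simplex_two_iff` — dedup.landed / split policy; origin part RootDecompZetaThreeFrontierWordRungTwoP1) -/
/-- Membership in `simplex_two_iff`, unfolded. [bookkeeping] -/
private theorem mem_simplex_two_iff (z : Fin 2 → ℝ) :
    z ∈ KZ.openOrderedSimplex 2 ↔ 0 < z 1 ∧ z 1 < z 0 ∧ z 0 < 1 := by
  constructor
  · rintro ⟨h0, h1, ha⟩
    exact ⟨h0 1, ha (show (0 : Fin 2) < 1 by decide), h1 0⟩
  · rintro ⟨h1, h10, h0⟩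
    refine ⟨Fin.forall_fin_two.mpr ⟨h1.trans h10, h1⟩, Fin.forall_fin_two.mpr ⟨h0, h10.trans h0⟩,
      Fin.strictAnti_iff_succ_lt.mpr (Fin.forall_fin_one.mpr ?_)⟩
    simpa using h10

/-! (private copy of `continuous_snoc` — dedup.landed / split policy; origin part RootDecompZetaThreeFrontierWordRungTwoP2) -/
/-- `t ↦ Fin.snoc x t` is continuous. [folklore] (verbatim private copy, `Theorems/…SupportCollapse`) -/
private theorem continuous_snoc {N : ℕ} (x : Fin N → ℝ) :
    Continuous fun t : ℝ => (Fin.snoc x t : Fin (N + 1) → ℝ) := by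
  refine continuous_pi fun j => ?_
  refine Fin.lastCases ?_ (fun i => ?_) j
  · simpa using continuous_id'
  · simpa using continuous_const

/-! (private copy of `exists_measurableEquiv_snoc` — dedup.landed / split policy; origin part RootDecompZetaThreeFrontierWordRungTwoP2) -/
/-- Splitting off the last coordinate, `ℝ^{N+1} ≃ ℝ^N × ℝ`, as a volume-preserving measurable
equivalence with inverse `(x, t) ↦ Fin.snoc x t`. [folklore] (verbatim private copy) -/
private theorem exists_measurableEquiv_snoc (N : ℕ) :
    ∃ e : (Fin (N + 1) → ℝ) ≃ᵐ (Fin N → ℝ) × ℝ,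
      MeasurePreserving e volume ((volume : Measure (Fin N → ℝ)).prod (volume : Measure ℝ)) ∧
      ∀ q, e.symm q = Fin.snoc q.1 q.2 := by
  refine ⟨(MeasurableEquiv.piFinSuccAbove (fun _ => ℝ) (Fin.last N)).trans
    MeasurableEquiv.prodComm, ?_, fun q => ?_⟩
  · refine (volume_preserving_piFinSuccAbove (fun _ => ℝ) (Fin.last N)).trans ?_
    rw [Measure.volume_eq_prod]
    exact Measure.measurePreserving_swap
  · show (MeasurableEquiv.piFinSuccAbove (fun _ => ℝ) (Fin.last N)).symm (q.2, q.1) = _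
    rw [MeasurableEquiv.piFinSuccAbove_symm_apply, Fin.insertNthEquiv_last]
    rfl

/-! (private copy of `newtonLeibniz_pack` — dedup.landed / split policy; origin part RootDecompZetaThreeFrontierWordRungTwoP2) -/
/-- **Newton–Leibniz over an open band, packaged.** Let `r` be a representation whose domain is
the open band `{(x, t) | x ∈ τ, a x < t < b x}` over a semialgebraic base `τ` with semialgebraic
`a < b`, and whose integrand agrees there with `f`; let `F`, `f` be semialgebraic on the closed band;
suppose `t ↦ F (x, t)` is continuous on `[a x, b x]` with derivative `f (x, ·)` on `(a x, b x)`
for `x ∈ τ`. Then `[r] ≡ [τ, F (x, b x) − F (x, a x)]` modulo relations; the base integrand is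
absolutely integrable by Fubini and the fundamental theorem of calculus.
[Kontsevich–Zagier 2001, §1.2, rule (3)] [folklore] (verbatim copy of
`Summit.KontsevichZagierPeriods.ArrangementNormalForm.JanusBands.IntegrateOut.newtonLeibniz_pack`) -/
private theorem newtonLeibniz_pack {N : ℕ} {τ : Set (Fin N → ℝ)} (hτ : IsSemialgebraic ℚ τ)
    {a b : (Fin N → ℝ) → ℝ} (ha : IsSemialgebraicFunOn ℚ τ a) (hb : IsSemialgebraicFunOn ℚ τ b)
    (hab : ∀ x ∈ τ, a x < b x) {f F : (Fin (N + 1) → ℝ) → ℝ}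
    (hf : IsSemialgebraicFunOn ℚ (KZlog.band τ a b) f)
    (hF : IsSemialgebraicFunOn ℚ (KZlog.band τ a b) F)
    (hcont : ∀ x ∈ τ, ContinuousOn (fun t => F (Fin.snoc x t)) (Icc (a x) (b x)))
    (hder : ∀ x ∈ τ, ∀ t ∈ Ioo (a x) (b x),
      HasDerivAt (fun s => F (Fin.snoc x s)) (f (Fin.snoc x t)) t)
    (r : KZ.IntegralRep (N + 1))
    (hrd : r.domain = {z | (Fin.init z : Fin N → ℝ) ∈ τ ∧ a (Fin.init z) < z (Fin.last N) ∧
      z (Fin.last N) < b (Fin.init z)})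
    (hri : EqOn r.integrand f r.domain) :
    ∃ r' : KZ.IntegralRep N, r'.domain = τ ∧
      (r'.integrand = fun x => F (Fin.snoc x (b x)) - F (Fin.snoc x (a x))) ∧
      KZ.of r - KZ.of r' ∈ KZ.relations := by
  have hτm : MeasurableSet τ := IsSemialgebraic.measurableSet_holds hτ
  have hBsa : IsSemialgebraic ℚ (KZlog.band τ a b) := KZlog.isSemialgebraic_band ha hb
  have hBm : MeasurableSet (KZlog.band τ a b) := IsSemialgebraic.measurableSet_holds hBsa
  have hsub : r.domain ⊆ KZlog.band τ a b := by
    rw [hrd]; exact fun z hz => ⟨hz.1, hz.2.1.le, hz.2.2.le⟩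
  have hdiff : KZlog.band τ a b \ r.domain ⊆
      {z | (Fin.init z : Fin N → ℝ) ∈ τ ∧ z (Fin.last N) = a (Fin.init z)} ∪
        {z | (Fin.init z : Fin N → ℝ) ∈ τ ∧ z (Fin.last N) = b (Fin.init z)} := by
    rw [hrd]
    rintro z ⟨⟨hzτ, h1, h2⟩, hz⟩
    simp only [mem_setOf_eq, not_and, not_lt] at hz
    rcases h1.lt_or_eq with h1 | h1
    · exact Or.inr ⟨hzτ, le_antisymm h2 (hz hzτ h1)⟩
    · exact Or.inl ⟨hzτ, h1.symm⟩
  have hnull : volume (KZlog.band τ a b \ r.domain) = 0 :=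
    measure_mono_null hdiff (measure_union_null (KZ.volume_graph_eq_zero ha)
      (KZ.volume_graph_eq_zero hb))
  have hfO : IntegrableOn f r.domain :=
    r.integrableOn.congr_fun hri (KZ.IntegralRep.measurableSet_domain_holds r)
  have hfB : IntegrableOn f (KZlog.band τ a b) := by
    rw [← Set.union_sdiff_cancel hsub]
    exact integrableOn_union.mpr ⟨hfO, IntegrableOn.of_measure_zero hnull⟩
  let r₂ : KZ.IntegralRep (N + 1) := ⟨KZlog.band τ a b, f, hBsa, hf, hfB⟩
  have h12 : KZ.of r - KZ.of r₂ ∈ KZ.relations := by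
    refine KZ.of_sub_of_mem_relations_of_null r r₂ ?_ hnull fun z hz => hri hz.1
    rw [Set.sdiff_eq_empty.mpr hsub, measure_empty]
  -- the base integrand and its semialgebraicity
  have hmap : ∀ {c : (Fin N → ℝ) → ℝ}, IsSemialgebraicFunOn ℚ τ c →
      (∀ x ∈ τ, c x ∈ Icc (a x) (b x)) →
      IsSemialgebraicFunOn ℚ τ (fun x => F (Fin.snoc x (c x))) := by
    intro c hc hcm
    have hφ : IsSemialgebraicMapOn ℚ τ (fun x => (Fin.snoc x (c x) : Fin (N + 1) → ℝ)) := by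
      refine IsSemialgebraicMapOn.of_forall hτ fun j => ?_
      refine Fin.lastCases ?_ (fun i => ?_) j
      · simpa using hc
      · simpa using isSemialgebraicFunOn_apply hτ i
    exact IsSemialgebraicFunOn.comp_isSemialgebraicMapOn_holds hF hφ
      fun x hx => KZlog.snoc_mem_band.mpr ⟨hx, hcm x hx⟩
  have hgsa : IsSemialgebraicFunOn ℚ τ (fun x => F (Fin.snoc x (b x)) - F (Fin.snoc x (a x))) :=
    IsSemialgebraicFunOn.sub_holds (hmap hb fun x hx => Set.right_mem_Icc.mpr (hab x hx).le)
      (hmap ha fun x hx => Set.left_mem_Icc.mpr (hab x hx).le)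
  -- integrability of the base integrand: Fubini and the fundamental theorem of calculus
  set G : (Fin (N + 1) → ℝ) → ℝ := (KZlog.band τ a b).indicator f with hG_def
  have hG : Integrable G := (integrable_indicator_iff hBm).mpr hfB
  obtain ⟨e, he, he_symm⟩ := exists_measurableEquiv_snoc N
  have hG2 : Integrable (fun q : (Fin N → ℝ) × ℝ => G (Fin.snoc q.1 q.2))
      ((volume : Measure (Fin N → ℝ)).prod (volume : Measure ℝ)) := by
    have h := ((he.symm e).integrable_comp_emb e.symm.measurableEmbedding (g := G)).mpr hG
    convert h using 1
    ext q
    simp [he_symm]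
  have hfib_in : ∀ x ∈ τ, (fun t => G (Fin.snoc x t)) =
      (Icc (a x) (b x)).indicator (fun t => f (Fin.snoc x t)) := by
    intro x hx
    ext t
    by_cases ht : t ∈ Icc (a x) (b x)
    · rw [indicator_of_mem ht, hG_def, indicator_of_mem (KZlog.snoc_mem_band.mpr ⟨hx, ht⟩)]
    · rw [indicator_of_notMem ht, hG_def,
        indicator_of_notMem (fun h => ht (KZlog.snoc_mem_band.mp h).2)]
  have hgx : ∀ x ∈ τ, Integrable (fun t => G (Fin.snoc x t)) →
      F (Fin.snoc x (b x)) - F (Fin.snoc x (a x)) = ∫ t, G (Fin.snoc x t) := by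
    intro x hx hxi
    rw [hfib_in x hx, integral_indicator measurableSet_Icc, integral_Icc_eq_integral_Ioc,
      ← intervalIntegral.integral_of_le (hab x hx).le]
    refine (intervalIntegral.integral_eq_sub_of_hasDerivAt_of_le (hab x hx).le (hcont x hx)
      (hder x hx) ?_).symm
    rw [intervalIntegrable_iff_integrableOn_Icc_of_le (hab x hx).le]
    have h' := hxi
    rw [hfib_in x hx] at h'
    exact (integrable_indicator_iff measurableSet_Icc).mp h'
  have hgi : IntegrableOn (fun x => F (Fin.snoc x (b x)) - F (Fin.snoc x (a x))) τ := by
    refine Integrable.mono' hG2.integral_norm_prod_left.integrableOn.integrable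
      (KZ.aestronglyMeasurable_of_isSemialgebraicFunOn hgsa hτm) ?_
    rw [ae_restrict_iff' hτm]
    filter_upwards [hG2.prod_right_ae] with x hx hxτ
    rw [hgx x hxτ hx]
    exact norm_integral_le_integral_norm _
  let r' : KZ.IntegralRep N :=
    ⟨τ, fun x => F (Fin.snoc x (b x)) - F (Fin.snoc x (a x)), hτ, hgsa, hgi⟩
  have h23 : KZ.of r₂ - KZ.of r' ∈ KZ.relations :=
    KZ.newtonLeibnizRel_subset_relations ⟨N, r₂, r', a, b, F, hF, ha, hb,
      fun x hx => (hab x hx).le, rfl, hcont, hder, fun x _ => rfl, rfl⟩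
  refine ⟨r', rfl, rfl, ?_⟩
  have : KZ.of r - KZ.of r' = (KZ.of r - KZ.of r₂) + (KZ.of r₂ - KZ.of r') := by abel
  rw [this]
  exact KZ.relations.add_mem h12 h23

/-! (private copy of `openOrderedSimplex_two_eq_band` — dedup.landed / split policy; origin part RootDecompZetaThreeFrontierWordRungTwoP2) -/
/-- `Δ₂` is the band `0 < t₁ < t₀` over `Δ₁` -/
private theorem openOrderedSimplex_two_eq_band : KZ.openOrderedSimplex 2 =
    {z : Fin 2 → ℝ | (Fin.init z : Fin 1 → ℝ) ∈ KZ.openOrderedSimplex 1 ∧ (0 : ℝ) < z (Fin.last 1) ∧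
      z (Fin.last 1) < (Fin.init z : Fin 1 → ℝ) (Fin.last 0)} := by
  ext z
  rw [mem_simplex_two_iff]
  simp only [mem_setOf_eq, mem_simplex_one_iff]
  rw [show (Fin.init z : Fin 1 → ℝ) 0 = z 0 from rfl, show (Fin.init z : Fin 1 → ℝ) (Fin.last 0) = z 0 from rfl,
    show z (Fin.last 1) = z 1 from rfl]
  constructor
  · rintro ⟨h1, h10, h0⟩; exact ⟨⟨h1.trans h10, h0⟩, h1, h10⟩
  · rintro ⟨⟨-, h0⟩, h1, h10⟩; exact ⟨h1, h10, h0⟩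

end RouteVocabularyMoves
/-! ## §14  The two move facts PROVED in file (gen 9): duality at weight 3 and divergence at weight ≤ 3

Gen 8/9 cited `DualityThree` and `DivergenceLEThree` as tree theorems BY NAME (modules unbuilt on the
farm).  Here both are PROVED from the calculus and Mathlib alone, so that item 28709 follows from the
SINGLE open statement `GZNormalFormWThree′` (`genusZeroThreeNormalForm_of_gz'`).
* duality = ONE change of variables (rule 2) by the order-reversing involution `tᵢ ↦ 1 - t₂₋ᵢ` of `Δ₃`
  (`|det| = 1` because it is an involution) — the dimension-3 twin of §12f's move;
* divergence = Fubini sections of an absolutely integrable function are a.e. integrable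
  (`Integrable.prod_right_ae` / `prod_left_ae` through the volume-preserving `Fin.snoc` / `Fin.cons`
  splittings), while a non-admissible word has on EVERY section over `Δ_w` a simple pole `C/t` at `t → 0`
  (last letter `ω₀`) or `C/(1-t)` at `t → 1` (first letter `ω₁`), which §12a's pole test rejects;
  `Δ_w` has positive volume. -/

section MovesProved
open Literature.ModelTheory.ExponentialFields (IsSemialgebraic)
/-! ### 14a  Duality at weight 3 by the involution of `Δ₃` -/

/-! ### 14b  Fubini sections: a.e. fibre integrability in the last and in the first coordinate -/

/-- Fubini: the last-coordinate sections of an integrable function are a.e. integrable. -/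
private theorem ae_integrableOn_snoc {N : ℕ} {B : Set (Fin (N + 1) → ℝ)} (hB : MeasurableSet B)
    {f : (Fin (N + 1) → ℝ) → ℝ} (hf : IntegrableOn f B) :
    ∀ᵐ x : Fin N → ℝ, IntegrableOn (fun t : ℝ => f (Fin.snoc x t))
      {t | (Fin.snoc x t : Fin (N + 1) → ℝ) ∈ B} := by
  obtain ⟨e, he, he_symm⟩ := exists_measurableEquiv_snoc N
  have h1 : Integrable (B.indicator f) volume := (integrable_indicator_iff hB).2 hf
  have h2 : Integrable (B.indicator f ∘ e.symm) ((volume : Measure (Fin N → ℝ)).prod volume) :=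
    ((he.symm e).integrable_comp_emb e.symm.measurableEmbedding).2 h1
  refine (h2.prod_right_ae).mono fun x hx => ?_
  have hm : MeasurableSet {t : ℝ | (Fin.snoc x t : Fin (N + 1) → ℝ) ∈ B} :=
    (continuous_snoc x).measurable hB
  refine (integrable_indicator_iff hm).1 (hx.congr (Filter.Eventually.of_forall fun t => ?_))
  show (B.indicator f ∘ e.symm) (x, t) = _
  rw [Function.comp_apply, he_symm]
  exact (Set.indicator_comp_right (fun t : ℝ => (Fin.snoc x t : Fin (N + 1) → ℝ)) (g := f)).symm

/-- an a.e. statement failing on a set of positive volume is absurd -/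
private theorem false_of_ae_of_forall_not {N : ℕ} {P : (Fin N → ℝ) → Prop} (h : ∀ᵐ x : Fin N → ℝ, P x)
    {S : Set (Fin N → ℝ)} (hS : ∀ x ∈ S, ¬ P x) (hvol : volume S ≠ 0) : False := by
  have h0 : volume {x | ¬ P x} = 0 := ae_iff.1 h
  have hle : volume S ≤ volume {x | ¬ P x} := measure_mono fun x hx => hS x hx
  rw [h0] at hle
  exact hvol (nonpos_iff_eq_zero.1 hle)

/-- Auxiliary step `volume_simplex_ne_zero`. [bookkeeping] -/
private theorem volume_simplex_ne_zero {N : ℕ} (hne : (KZ.openOrderedSimplex N).Nonempty) :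
    volume (KZ.openOrderedSimplex N) ≠ 0 :=
  (KZ.isOpen_openOrderedSimplex N).measure_ne_zero volume hne

/-- Auxiliary step `simplex_one_nonempty`. [bookkeeping] -/
private theorem simplex_one_nonempty : (KZ.openOrderedSimplex 1).Nonempty :=
  ⟨fun _ => 1 / 2, (mem_simplex_one_iff _).2 ⟨by norm_num, by norm_num⟩⟩

/-! ### 14c  Divergence templates: a simple pole on every section -/

/-! ### 14d  Sections of `Δ₂` and `Δ₃` -/

/-- Auxiliary step `snoc_one_zero`. [bookkeeping] -/
private theorem snoc_one_zero (x : Fin 1 → ℝ) (t : ℝ) : (Fin.snoc x t : Fin 2 → ℝ) 0 = x 0 := rfl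

/-- Auxiliary step `snoc_one_one`. [bookkeeping] -/
private theorem snoc_one_one (x : Fin 1 → ℝ) (t : ℝ) : (Fin.snoc x t : Fin 2 → ℝ) 1 = t := rfl

/-- Auxiliary step `snoc_section_two`. [bookkeeping] -/
private theorem snoc_section_two {x : Fin 1 → ℝ} (hx : x ∈ KZ.openOrderedSimplex 1) :
    {t : ℝ | (Fin.snoc x t : Fin 2 → ℝ) ∈ KZ.openOrderedSimplex 2} = Ioo 0 (x 0) := by
  obtain ⟨hx0, hx1⟩ := (mem_simplex_one_iff x).1 hx
  ext t
  rw [mem_setOf_eq, mem_simplex_two_iff, snoc_one_zero, snoc_one_one, mem_Ioo]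
  exact ⟨fun h => ⟨h.1, h.2.1⟩, fun h => ⟨h.1, h.2, hx1⟩⟩

/-! ### 14e  Divergence at weights 2 and 3, and `DivergenceLEThree` PROVED -/

/-! ### 14f  Item 28709 from ONE open statement -/

end MovesProved
/-! ## §15  RUNG-2 ENGINES (gen 9 addendum 2): the three convergent moves on `Δ₂` that the rung-2 algorithm iterates, proved for
ARBITRARY semialgebraic data — (E1) Newton–Leibniz in the last coordinate over `Δ₁` with the fibre `(0, t₀)` (`nl_two`), and its
boundary-free form (`nl_two_zero`: a representation of `∂₁F` with `F(t₀,0) = F(t₀,t₀)` is a relation); (E2) the duality involution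
`σ(t₀,t₁) = (1-t₁,1-t₀)` of `Δ₂` as ONE rule-2 move for any integrand (`dualityTwo`); (E3) Newton–Leibniz over the point for `Δ₁`
(`nl_one`).  The RUNG-2 ALGORITHM (NODE.md §(E)): split an integrable genus-zero `P/(t₀^β(1-t₁)^γ)` into corner classes
`C(j,k;β,γ) = t₁^j(1-t₀)^k/(t₀^β(1-t₁)^γ)`, `j ≥ β-1`, `k ≥ γ-1` (rule 1b, every piece integrable); for `β, γ ≥ 1` the TAYLOR-INTERPOLATED
primitive `F = A(t₀)(R(t₁) - R̂(t₀,t₁))`, `R̂ = -λ Σ_{n<β-1} t₁^{n+1}/(n+1) + c(t₀)t₁`, `c = (R(t₀) + λ Σ_{1≤n<β} t₀^n/n)/t₀`, has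
`F(t₀,0) = F(t₀,t₀) = 0` and `C(j,k;β,γ) - ∂₁F = λ·C(β-1,k;β,1) + q(t₀)/t₀` with `q` a POLYNOMIAL (E1 twice + E3: `≡ λ·C(β-1,k;β,1) + [pt,∫q]`);
E2 swaps `(β,γ)`; a second pass reaches `γ = β = 1`, where `(1-t₀)^k ω₀ω₁` expands into `ω₀ω₁ +` classes with `β = 0`; classes with `β = 0` or
`γ = 0` are rational by E1 + rung 1.  The specimen §12f is the instance `(j,k,β,γ) = (1,1,2,2)`; the hand instance `(2,1,3,2)` has value `1/2`. -/

section RungTwoEngines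
open Literature.ModelTheory.ExponentialFields (IsSemialgebraic)
/-- **(E1) Newton–Leibniz on `Δ₂` in the last coordinate.**  If `F(t₀, ·)` is continuous on `[0, t₀]` with derivative `f(t₀, ·)` on
`(0, t₀)` for every `t₀ ∈ (0,1)`, `f`, `F` semialgebraic on the closed band, then every representation of `f` on `Δ₂` is congruent to
`[Δ₁, F(t₀,t₀) - F(t₀,0)]`. [Kontsevich–Zagier 2001 §1.2 rule (3)] -/
theorem nl_two {f F : (Fin 2 → ℝ) → ℝ}
    (hf : IsSemialgebraicFunOn ℚ (KZlog.band (KZ.openOrderedSimplex 1) (fun _ : Fin 1 → ℝ => (0 : ℝ))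
      (fun y : Fin 1 → ℝ => y (Fin.last 0))) f)
    (hF : IsSemialgebraicFunOn ℚ (KZlog.band (KZ.openOrderedSimplex 1) (fun _ : Fin 1 → ℝ => (0 : ℝ))
      (fun y : Fin 1 → ℝ => y (Fin.last 0))) F)
    (hcont : ∀ y ∈ KZ.openOrderedSimplex 1, ContinuousOn (fun t => F (Fin.snoc y t)) (Icc 0 (y (Fin.last 0))))
    (hder : ∀ y ∈ KZ.openOrderedSimplex 1, ∀ t ∈ Ioo 0 (y (Fin.last 0)),
      HasDerivAt (fun s => F (Fin.snoc y s)) (f (Fin.snoc y t)) t)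
    (r : KZ.IntegralRep 2) (hd : r.domain = KZ.openOrderedSimplex 2) (hi : EqOn r.integrand f r.domain) :
    ∃ r' : KZ.IntegralRep 1, r'.domain = KZ.openOrderedSimplex 1 ∧
      (r'.integrand = fun y => F (Fin.snoc y (y (Fin.last 0))) - F (Fin.snoc y 0)) ∧
      KZ.of r - KZ.of r' ∈ KZ.relations := by
  have hτ₁ := KZ.isSemialgebraic_openOrderedSimplex 1
  have ha₁ : IsSemialgebraicFunOn ℚ (KZ.openOrderedSimplex 1) (fun _ : Fin 1 → ℝ => (0 : ℝ)) :=
    (isSemialgebraicFunOn_aeval hτ₁ (0 : MvPolynomial (Fin 1) ℚ)).congr fun y _ => by simp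
  have hb₁ : IsSemialgebraicFunOn ℚ (KZ.openOrderedSimplex 1) (fun y : Fin 1 → ℝ => y (Fin.last 0)) :=
    (isSemialgebraicFunOn_aeval hτ₁ (MvPolynomial.X (Fin.last 0))).congr fun y _ => by simp
  have hab₁ : ∀ y ∈ KZ.openOrderedSimplex 1,
      (fun _ : Fin 1 → ℝ => (0 : ℝ)) y < (fun y : Fin 1 → ℝ => y (Fin.last 0)) y :=
    fun y hy => ((mem_simplex_one_iff y).1 hy).1
  exact newtonLeibniz_pack hτ₁ ha₁ hb₁ hab₁ hf hF hcont hder r (by rw [hd]; exact openOrderedSimplex_two_eq_band) hi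

end RungTwoEngines
end Summit.KontsevichZagierPeriods.RootDecompZetaThreeFrontier.WordLayer
end

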